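import Mathlib.MeasureTheory.Integral.Layercake
import Mathlib.Analysis.SpecialFunctions.ImproperIntegrals
import Summits.AtomisticToContinuum.HydrodynamicLimit.Theorems.OneFlightGossipEngineCollisionActivityTailsEndpointTails
import HarnessLib

/-!
# `TransferActivityTails` (stmt-AtomisticToContinuum-16624), line `IdeatorOneSketch`: stub `stub_expTailLayerCake`

Layer cake under an exponential tail (pure measure theory, arbitrary measure — no finiteness or σ-finiteness).
For an a.e.-measurable real `f` on `(Ω, μ)` with `μ {x ≤ f} ≤ C e^{-c x}` for all `x ≥ x₀ > 0` (`c > 0`, `C ≥ 0`):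

  `∫⁻ ofReal (𝟙{f > x₀} f) dμ ≤ ofReal (C (x₀ + 1/c) e^{-c x₀})`.

Proof: by the layer-cake formula (`MeasureTheory.lintegral_eq_lintegral_meas_lt`)
`∫⁻ ofReal (tailFn x₀ ∘ f) dμ = ∫⁻ t in Ioi 0, μ {t < tailFn x₀ (f ·)}`; for `t > 0` the level set
`{t < tailFn x₀ (f ·)}` is contained in `{max t x₀ ≤ f}` (`max_le_of_lt_tailFn`), of measure `≤ C e^{-c max t x₀}`;
splitting `Ioi 0 = Ioc 0 x₀ ∪ Ioi x₀` gives `≤ x₀ · C e^{-c x₀} + ∫_{x₀}^∞ C e^{-ct} dt = C (x₀ + 1/c) e^{-c x₀}`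
(`setLIntegral_const`, `Real.volume_Ioc`, `integral_exp_mul_Ioi`).  The general measure-space form is
`lintegral_tailFn_le_of_exp_tail`; the registered statement `ExpTailLayerCake` is its specialisation to the phase
space `Cfg N` (its hypothesis `f ≥ 0` is not needed: `tailFn x₀ ≥ 0` as soon as `x₀ ≥ 0`,
an indicator of `y ↦ y` on `{x₀ < y} ⊆ (0, ∞)`; proved inline — this file deliberately imports nothing from the
predecessor crux's `CollisionActivityTails/Negative/` files).
-/

noncomputable section

open MeasureTheory Set Filter Topology
open scoped ENNReal InnerProductSpace BigOperators

namespace Summit.AtomisticToContinuum.HydrodynamicLimit.Theorems.TransferActivityTailsExpTailLayerCake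

open Literature.MathematicalPhysics.KineticTheory Literature.Analysis.FluidPDE
open Summit.AtomisticToContinuum.HydrodynamicLimit.Theorems.CollisionActivityTailsEndpointTails
  (Flow Cfg window tailFn tailFn_of_lt tailFn_of_le measurable_tailFn ae_mem_good_localGibbsLaw)

/-! ## The statement (verbatim from the line skeleton) -/

/-- Layer cake under an exponential tail: for an a.e.-measurable `f ≥ 0` with `μ{x ≤ f} ≤ C e^{-c x}` for all
`x ≥ x₀ > 0`: `∫ f 𝟙{f > x₀} dμ ≤ C (x₀ + 1/c) e^{-c x₀}` (`= x₀ μ{f > x₀} + ∫_{x₀}^∞ μ{f > x} dx`) — registered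
stub signature of line IdeatorOneSketch, crux TransferActivityTails (stmt-AtomisticToContinuum-16624) —
route-internal, not a cited fact. -/
def ExpTailLayerCake : Prop :=
  ∀ (N : ℕ) (μ : Measure (Cfg N)) (f : Cfg N → ℝ), AEMeasurable f μ → (∀ z, 0 ≤ f z) →
    ∀ (x₀ c C : ℝ), 0 < x₀ → 0 < c → 0 ≤ C →
    (∀ x : ℝ, x₀ ≤ x → μ {z | x ≤ f z} ≤ ENNReal.ofReal (C * Real.exp (-(c * x)))) →
    ∫⁻ z, ENNReal.ofReal (tailFn x₀ (f z)) ∂μ ≤ ENNReal.ofReal (C * (x₀ + c⁻¹) * Real.exp (-(c * x₀)))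

/-! ## The proof -/

/-- Level sets of the tail functional: for `t > 0`, `t < tailFn x₀ y` forces `max t x₀ ≤ y`
(on the tail `x₀ < y` and `t < y`; off the tail `tailFn x₀ y = 0 < t` is impossible). [folklore] -/
theorem max_le_of_lt_tailFn {x₀ t y : ℝ} (ht : 0 < t) (h : t < tailFn x₀ y) : max t x₀ ≤ y := by
  by_cases hy : x₀ < y
  · rw [tailFn_of_lt hy] at h
    exact max_le h.le hy.le
  · rw [tailFn_of_le (not_lt.1 hy)] at h
    exact absurd (ht.trans h) (lt_irrefl 0)

/-- The exponential piece of the layer cake: `∫⁻ t in Ioi x₀, ofReal (C e^{-ct}) = ofReal (C e^{-c x₀} / c)` for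
`c > 0`, `C ≥ 0` (`integral_exp_mul_Ioi`, moved to `ℝ≥0∞` by `ofReal_integral_eq_lintegral_ofReal`). [folklore] -/
theorem lintegral_Ioi_const_mul_exp_neg (x₀ : ℝ) {c C : ℝ} (hc : 0 < c) (hC : 0 ≤ C) :
    ∫⁻ t in Ioi x₀, ENNReal.ofReal (C * Real.exp (-(c * t))) =
      ENNReal.ofReal (C * Real.exp (-(c * x₀)) / c) := by
  have hc' : -c < 0 := neg_lt_zero.2 hc
  have hint : Integrable (fun t : ℝ => C * Real.exp (-(c * t))) (volume.restrict (Ioi x₀)) := by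
    have h := Integrable.const_mul (integrableOn_exp_mul_Ioi hc' x₀) C
    simpa only [neg_mul] using h
  rw [← ofReal_integral_eq_lintegral_ofReal hint (ae_of_all _ fun t => mul_nonneg hC (Real.exp_pos _).le)]
  congr 1
  have h := integral_exp_mul_Ioi hc' x₀
  simp only [neg_mul] at h
  rw [integral_const_mul, h, neg_div_neg_eq, mul_div_assoc]

/-- **Layer cake under an exponential tail** (general measure space, arbitrary measure).  For an a.e.-measurable
real `f` on `(Ω, μ)` with `μ {x ≤ f} ≤ ofReal (C e^{-c x})` for all `x ≥ x₀`, where `x₀ > 0`, `c > 0`, `C ≥ 0`: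
`∫⁻ ofReal (tailFn x₀ (f ·)) dμ ≤ ofReal (C (x₀ + c⁻¹) e^{-c x₀})`.  Layer cake
(`lintegral_eq_lintegral_meas_lt`), the level-set inclusion `{t < tailFn x₀ ∘ f} ⊆ {max t x₀ ≤ f}` for `t > 0`,
and the split `Ioi 0 = Ioc 0 x₀ ∪ Ioi x₀`: the first piece is the constant `ofReal (C e^{-c x₀})` over an interval
of length `x₀`, the second is `∫_{x₀}^∞ C e^{-ct} dt = C e^{-c x₀} / c`. [folklore] -/
theorem lintegral_tailFn_le_of_exp_tail {Ω : Type*} [MeasurableSpace Ω] (μ : Measure Ω) {f : Ω → ℝ}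
    (hf : AEMeasurable f μ) {x₀ c C : ℝ} (hx₀ : 0 < x₀) (hc : 0 < c) (hC : 0 ≤ C)
    (htail : ∀ x : ℝ, x₀ ≤ x → μ {z | x ≤ f z} ≤ ENNReal.ofReal (C * Real.exp (-(c * x)))) :
    ∫⁻ z, ENNReal.ofReal (tailFn x₀ (f z)) ∂μ ≤ ENNReal.ofReal (C * (x₀ + c⁻¹) * Real.exp (-(c * x₀))) := by
  have hg0 : 0 ≤ᵐ[μ] fun z => tailFn x₀ (f z) :=
    ae_of_all _ fun z => Set.indicator_nonneg (fun _ (h : x₀ < _) => hx₀.le.trans h.le) _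
  have hgm : AEMeasurable (fun z => tailFn x₀ (f z)) μ := (measurable_tailFn x₀).comp_aemeasurable hf
  rw [lintegral_eq_lintegral_meas_lt μ hg0 hgm]
  -- the level sets of `tailFn x₀ ∘ f` above a positive level `t` sit inside `{max t x₀ ≤ f}`
  have hlev : ∀ t ∈ Ioi (0 : ℝ),
      μ {z | t < tailFn x₀ (f z)} ≤ ENNReal.ofReal (C * Real.exp (-(c * max t x₀))) := fun t ht =>
    (measure_mono fun z hz => max_le_of_lt_tailFn ht hz).trans (htail (max t x₀) (le_max_right _ _))
  have hA0 : 0 ≤ C * Real.exp (-(c * x₀)) := mul_nonneg hC (Real.exp_pos _).le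
  calc ∫⁻ t in Ioi 0, μ {z | t < tailFn x₀ (f z)}
      ≤ ∫⁻ t in Ioi 0, ENNReal.ofReal (C * Real.exp (-(c * max t x₀))) := setLIntegral_mono' measurableSet_Ioi hlev
    _ = ∫⁻ t in Ioc 0 x₀ ∪ Ioi x₀, ENNReal.ofReal (C * Real.exp (-(c * max t x₀))) := by
        rw [Ioc_union_Ioi_eq_Ioi hx₀.le]
    _ ≤ (∫⁻ t in Ioc 0 x₀, ENNReal.ofReal (C * Real.exp (-(c * max t x₀)))) +
          ∫⁻ t in Ioi x₀, ENNReal.ofReal (C * Real.exp (-(c * max t x₀))) := lintegral_union_le _ _ _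
    _ = (∫⁻ _t in Ioc 0 x₀, ENNReal.ofReal (C * Real.exp (-(c * x₀)))) +
          ∫⁻ t in Ioi x₀, ENNReal.ofReal (C * Real.exp (-(c * t))) := by
        congr 1
        · exact setLIntegral_congr_fun measurableSet_Ioc fun t ht => by rw [max_eq_right ht.2]
        · exact setLIntegral_congr_fun measurableSet_Ioi fun t ht => by rw [max_eq_left (le_of_lt ht)]
    _ = ENNReal.ofReal (C * Real.exp (-(c * x₀))) * ENNReal.ofReal x₀ +
          ENNReal.ofReal (C * Real.exp (-(c * x₀)) / c) := by
        rw [setLIntegral_const, Real.volume_Ioc, sub_zero, lintegral_Ioi_const_mul_exp_neg x₀ hc hC]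
    _ = ENNReal.ofReal (C * Real.exp (-(c * x₀)) * x₀ + C * Real.exp (-(c * x₀)) / c) := by
        rw [ENNReal.ofReal_add (mul_nonneg hA0 hx₀.le) (div_nonneg hA0 hc.le), ENNReal.ofReal_mul hA0]
    _ = ENNReal.ofReal (C * (x₀ + c⁻¹) * Real.exp (-(c * x₀))) := by
        congr 1
        rw [div_eq_mul_inv]
        ring

/-- Stub 4 (registered): layer cake under an exponential tail — the specialisation of
`lintegral_tailFn_le_of_exp_tail` to the phase space `Cfg N` (the hypothesis `f ≥ 0` is not used). [folklore] -/
theorem stub_expTailLayerCake : ExpTailLayerCake := by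
  intro N μ f hf _hf0 x₀ c C hx₀ hc hC htail
  exact lintegral_tailFn_le_of_exp_tail μ hf hx₀ hc hC htail

end Summit.AtomisticToContinuum.HydrodynamicLimit.Theorems.TransferActivityTailsExpTailLayerCake

end
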